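import Summits.MatrixMultiplication.Statement

/-!
# MatrixMultiplication / AsymptoticSpectrum — monotonicity of `R(⟨n,n,n⟩)`

Route `MatrixMultiplication/AsymptoticSpectrum`, item `stmt-MatrixMultiplication-0585` (rank 5):
`n ≤ m → R(⟨n,n,n⟩) ≤ R(⟨m,m,m⟩)` over any field (indeed any commutative semiring), by
zero-padding: `⟨n,n,n⟩` is the restriction of `⟨m,m,m⟩` along the coordinate embeddings
`Fin n ↪ Fin m` (Bläser 2013, §5). The general restriction lemma is stated with an explicit
decomposition witness because `tensorRank` takes the junk value `0` when no finite decomposition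
exists (infinite index types).
-/

noncomputable section

open scoped BigOperators

namespace Literature.CplxAlg

universe u v₁ v₂ v₃ w₁ w₂ w₃

section Restrict

variable {K : Type u} [CommSemiring K] {ι : Type v₁} {κ : Type v₂} {μ : Type v₃}
  {ι' : Type w₁} {κ' : Type w₂} {μ' : Type w₃}

/-- Restriction along index maps does not increase the rank, provided the tensor has some finite
triad decomposition (automatic over finite index types, `tensorRank_le_card`).
(Bläser 2013, §4: `t' ≤ t ⇒ R(t') ≤ R(t)`, the special case of coordinate restrictions.) [cite: Blaser2013, §4] -/
theorem tensorRank_comp_le (t : ι → κ → μ → K) (f : ι' → ι) (g : κ' → κ) (h : μ' → μ)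
    (hne : ∃ (r : ℕ) (w : Fin r → ι → K) (u : Fin r → κ → K) (v : Fin r → μ → K),
      t = ∑ i, Literature.Computability.AlgebraicComplexity.triad (w i) (u i) (v i)) :
    Literature.Computability.AlgebraicComplexity.tensorRank (fun a b c => t (f a) (g b) (h c)) ≤ Literature.Computability.AlgebraicComplexity.tensorRank t := by
  classical
  set S : Set ℕ := {r : ℕ | ∃ (w : Fin r → ι → K) (u : Fin r → κ → K) (v : Fin r → μ → K),
    t = ∑ i, Literature.Computability.AlgebraicComplexity.triad (w i) (u i) (v i)} with hS
  have hSne : S.Nonempty := by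
    obtain ⟨r, w, u, v, e⟩ := hne
    exact ⟨r, w, u, v, e⟩
  obtain ⟨w, u, v, e⟩ := Nat.sInf_mem hSne
  have hR : Literature.Computability.AlgebraicComplexity.tensorRank t = sInf S := rfl
  rw [hR]
  refine Literature.Computability.AlgebraicComplexity.tensorRank_le_of_eq_sum (fun i a => w i (f a)) (fun i b => u i (g b))
    (fun i c => v i (h c)) ?_
  funext a b c
  conv_lhs => rw [e]
  simp [Finset.sum_apply, Literature.Computability.AlgebraicComplexity.triad]

/-- Over finite index types every tensor is the sum of the coordinate triads
`t_{abc} e_a ⊗ e_b ⊗ e_c` (Bläser 2013, §4). [cite: Blaser2013, §4] -/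
theorem eq_sum_triad_single [Fintype ι] [Fintype κ] [Fintype μ] [DecidableEq ι] [DecidableEq κ]
    [DecidableEq μ] (t : ι → κ → μ → K) :
    t = ∑ p : ι × κ × μ, Literature.Computability.AlgebraicComplexity.triad (Pi.single p.1 (t p.1 p.2.1 p.2.2)) (Pi.single p.2.1 (1 : K))
      (Pi.single p.2.2 (1 : K)) := by
  funext a b c
  rw [Finset.sum_apply, Finset.sum_apply, Finset.sum_apply]
  simp only [Literature.Computability.AlgebraicComplexity.triad_apply]
  rw [Fintype.sum_eq_single (a, b, c)]
  · simp
  · rintro ⟨a', b', c'⟩ hne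
    by_cases ha : a' = a
    · subst ha
      by_cases hb : b' = b
      · subst hb
        have hc : c' ≠ c := fun h => hne (by subst h; rfl)
        simp [Ne.symm hc]
      · simp [Pi.single_apply, Ne.symm hb]
    · simp [Pi.single_apply, Ne.symm ha]

/-- Over finite index types every tensor has a finite triad decomposition (so the infimum defining
`tensorRank` is over a non-empty set). [cite: Blaser2013, §4] -/
theorem exists_eq_sum_triad [Fintype ι] [Fintype κ] [Fintype μ] (t : ι → κ → μ → K) :
    ∃ (r : ℕ) (w : Fin r → ι → K) (u : Fin r → κ → K) (v : Fin r → μ → K),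
      t = ∑ i, Literature.Computability.AlgebraicComplexity.triad (w i) (u i) (v i) := by
  classical
  set e := Fintype.equivFin (ι × κ × μ)
  refine ⟨Fintype.card (ι × κ × μ), fun i => Pi.single (e.symm i).1 (t (e.symm i).1 (e.symm i).2.1 (e.symm i).2.2),
    fun i => Pi.single (e.symm i).2.1 1, fun i => Pi.single (e.symm i).2.2 1, ?_⟩
  exact (eq_sum_triad_single t).trans (Fintype.sum_equiv e _ _ fun s => by simp [e])

end Restrict

section MatMul

variable (K : Type u) [CommSemiring K]

/-- Zero-padding: for `n ≤ m`, `⟨n,n,n⟩` is the restriction of `⟨m,m,m⟩` along the embeddings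
`Fin n ↪ Fin m` on every coordinate. [cite: Blaser2013, §5] -/
theorem matMulTensor_eq_comp_castLE {n m : ℕ} (h : n ≤ m) :
    Literature.Computability.AlgebraicComplexity.matMulTensor K n n n = fun a b c =>
      Literature.Computability.AlgebraicComplexity.matMulTensor K m m m (Prod.map (Fin.castLE h) (Fin.castLE h) a)
        (Prod.map (Fin.castLE h) (Fin.castLE h) b) (Prod.map (Fin.castLE h) (Fin.castLE h) c) := by
  funext a b c
  simp [Literature.Computability.AlgebraicComplexity.matMulTensor, Prod.map, Fin.ext_iff]

/-- Settles `stmt-MatrixMultiplication-0585`: monotonicity of the rank of matrix multiplication in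
the size, `n ≤ m → R(⟨n,n,n⟩) ≤ R(⟨m,m,m⟩)`, over any commutative semiring (Bläser 2013, §5;
zero-padding). [cite: Blaser2013, §5] -/
theorem tensorRank_matMulTensor_mono {n m : ℕ} (h : n ≤ m) :
    Literature.Computability.AlgebraicComplexity.tensorRank (Literature.Computability.AlgebraicComplexity.matMulTensor K n n n) ≤ Literature.Computability.AlgebraicComplexity.tensorRank (Literature.Computability.AlgebraicComplexity.matMulTensor K m m m) := by
  classical
  rw [matMulTensor_eq_comp_castLE K h]
  exact tensorRank_comp_le _ _ _ _ (exists_eq_sum_triad (Literature.Computability.AlgebraicComplexity.matMulTensor K m m m))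

/-- `stmt-MatrixMultiplication-0585`, exact signature (fields). [cite: Blaser2013, §5] -/
theorem tensorRank_matMulTensor_monotone :
    ∀ (K : Type) [Field K] (n m : ℕ), n ≤ m →
      Literature.Computability.AlgebraicComplexity.tensorRank (Literature.Computability.AlgebraicComplexity.matMulTensor K n n n) ≤
        Literature.Computability.AlgebraicComplexity.tensorRank (Literature.Computability.AlgebraicComplexity.matMulTensor K m m m) :=
  fun K _ _ _ h => tensorRank_matMulTensor_mono K h

end MatMul

end Literature.CplxAlg
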